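import Summits.ResolutionOfSingularities.ResolutionOfSingularities.Theorems.HilbertSamuelEliminationSigmaMaxModificationsCorridor3CPFramePropagationStepTracked
import Summits.ResolutionOfSingularities.ResolutionOfSingularities.Theorems.HilbertSamuelEliminationSigmaMaxModificationsCorridor3CPFrameMemberSaturation
import Literature.AlgebraicGeometry.Resolution.BlowupSNC
import Literature.AlgebraicGeometry.Resolution.MarkedIdealsEtale
import HarnessLib

/-!
# [OURS · L1 W4.2] D18 (G8): E-ADAPTED PROPAGATION — a CP frame reading the boundary members through `x_n` as coordinate hyperplanes `(u_j)`
# propagates to a CP frame at every near point `x'` reading the EXCEPTIONAL divisor as `(u'_{j₀})` and the STRICT TRANSFORM of each old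
# member either not at all (it misses `x'`) or as the hyperplane `(u'_j)` WITH THE SAME INDEX `j`
# (cell res-hironaka, LADDER-RESOLUTION rung L; slot W4.2, crux chain w42 `SigmaMaxModificationsCorridor3` stmt-ResolutionOfSingularities-19249;
# `--supports stmt-ResolutionOfSingularities-19249 --as helper`; res-L1-w42-plan-1 RULING v3.14-42 part 2 (KG)(2) «(G8) E-adapted propagation →
# hread_menu»; hand res-D-brk-3 (gen 7), file F2c of DESIGN 17:06:09Z)

SCHEME-SIDE (universe `0`), 0 `def`s, every declaration PROVED; OURS bookkeeping; NOT a statement of Hironaka's manuscript [Hironaka2017] nor of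
[CossartJannsenSaito2020]/[CossartPiltant2019]. AI-written, weaker than expert review.

* **`IsCPFrame.exists_isCPFrame_blowup_adapted`** — in the setting of the landed D18 (i) step (a CP frame `(R, u, h, φ)` of the reached stage `s`
  reading the canonical centre `C` as `V(X, u_T)` legally; `x'` a closed point of `Bl_C` over `x_n` in the `ν`-stratum): there is a CP frame
  `(R', u', h', φ')` at `x'` over a COMPLETE base with the same degree and `δ ≥ 1`, and an index `j₀ ∈ T`, such that
  (E) the exceptional divisor `𝓘(D) = C·𝒪_{Bl}` reads `(stalkIdeal (C.comap π) x')·B' = (ū'_{j₀})`;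
  (M) every ideal sheaf `K` on `X_n` read at `x_n` as `(ū_j)` (a boundary member through `x_n` in an E-adapted frame) has strict transform
  `strictTransformIdeal π C K` (= o1's `Sigma.Boundary.memberTransform C K`, the body of `Boundary.next`) whose stalk at `x'` is EITHER `⊤` (the
  transform misses `x'`) OR reads `(ū'_j)` with the SAME index `j ≠ j₀`.
  Proof: the tracked step (p-StepTracked: `φ' ∘ π♯ = β ∘ φ`, `β(r̄) = ι r`, index-preserving `u'`), the stalk formula `stalkIdeal_strictTransformIdeal`
  (saturation by the exceptional ideal), flat base change of colon ideals along `φ'` (`Ideal.map_colon_of_flat`, Matsumura 7.4 (iii)), and the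
  saturation arithmetic of `…CPFrameMemberSaturation` in `R'[X]/(h')`.

References: CP 2019 Def. 2.6–2.7, Prop. 2.7 [CossartPiltant2019]; Görtz–Wedhorn I (13.19) [GortzWedhorn2020]; Matsumura Thm. 7.4 [Matsumura1987];
Kollár 2007 Def. 3.65–3.66 [Kollar2007].
-/

noncomputable section

set_option linter.dupNamespace false

open CategoryTheory AlgebraicGeometry TopologicalSpace IsLocalRing Polynomial
open Literature.AlgebraicGeometry.Resolution Literature.RingTheory.HilbertSamuel
open Summit.ResolutionOfSingularities.ResolutionOfSingularities.Theorems.CampaignW42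
open Summit.ResolutionOfSingularities.ResolutionOfSingularities.Theorems.SigmaMaxModificationsCorridor3.Helpers

namespace Summit.ResolutionOfSingularities.ResolutionOfSingularities.Theorems.SigmaMaxModificationsCorridor3.Moving

/-- Stalk ideals at equal points correspond under `stalkCongr`. [folklore] -/
theorem stalkIdeal_eq_map_stalkCongr_hom_of_eq {X : Scheme.{0}} {x y : X} (hxy : x = y) (K : X.IdealSheafData) :
    stalkIdeal K y = (stalkIdeal K x).map (X.presheaf.stalkCongr (Inseparable.of_eq hxy)).hom.hom := by
  subst hxy
  simp only [TopCat.Presheaf.stalkCongr_hom, TopCat.Presheaf.stalkSpecializes_refl, CommRingCat.hom_id, Ideal.map_id]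

/-- In a local ring, an ideal whose extension along a local homomorphism with `𝔪 ↦ 𝔪` is the unit ideal is the unit ideal. [folklore] -/
theorem eq_top_of_map_eq_top_of_map_maximalIdeal {O B : Type*} [CommRing O] [CommRing B] [IsLocalRing O] [IsLocalRing B]
    (f : O →+* B) (hmap : (maximalIdeal O).map f = maximalIdeal B) {I : Ideal O} (hI : I.map f = ⊤) : I = ⊤ := by
  by_contra hne
  have h1 : I.map f ≤ maximalIdeal B := hmap ▸ Ideal.map_mono (IsLocalRing.le_maximalIdeal hne)
  exact (maximalIdeal.isMaximal B).ne_top (top_le_iff.mp (hI ▸ h1))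

set_option maxHeartbeats 800000 in
-- the frame data of the tracked step are large terms
/-- [OURS · L1 W4.2] **D18 (i) E-ADAPTED: the propagated CP frame reads the exceptional divisor and the transformed old members as coordinate
hyperplanes with the same indices.** See the module docstring. [cite: CossartPiltant2019, Def. 2.6–2.7 and Prop. 2.7 (arXiv v1 p. 14)]
[cite: GortzWedhorn2020, (13.19) p. 414] [cite: Matsumura1987, Thm. 7.4 (iii)] -/
theorem IsCPFrame.exists_isCPFrame_blowup_adapted {p : ℕ} {R₀ : ∀ S : Scheme.{0}, CentreSeq S → Prop}
    (hRf : OracleFunctional R₀) (hRa : OracleAdmissible R₀) {ν : ℕ → ℕ} {X₀ : Scheme.{0}} [IsLocallyNoetherian X₀] {x : X₀}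
    (hX : IsMaximalOrigin p 3 ν X₀ x) {s : MarkedStage.{0}} (hs : Reaches R₀ 3 ν (MarkedStage.init X₀ x) s)
    (C : s.W.IdealSheafData) (P' : Option (Pending (blowup C))) (hln' : IsLocallyNoetherian (blowup C)) (x' : ↥(blowup C))
    (hcs : IsCanonicalStep R₀ 3 ν s.L s.P C P') (hx' : (blowup.π C).base x' = s.pt) (hcl : IsClosed ({x'} : Set ↥(blowup C)))
    (hstr : x' ∈ Scheme.hsStratum (blowup C) 3 ν)
    {R : Type} [CommRing R] {u : Fin 3 → R} {h : R[X]}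
    {φ : (s.W.presheaf.stalk s.pt : Type) →+* R[X] ⧸ Ideal.span {h}} (hF : IsCPFrame s R u h φ) (T : Finset (Fin 3))
    (hJ : (stalkIdeal C s.pt).map φ =
      ((Ideal.span (u '' ↑T)).map (Polynomial.C : R →+* R[X]) ⊔ Ideal.span {X}).map (Ideal.Quotient.mk (Ideal.span {h})))
    (hcoT : ∀ i ∈ Finset.Icc 1 h.natDegree, h.coeff (h.natDegree - i) ∈ Ideal.span (u '' ↑T) ^ i) :
    ∃ (R' : Type) (_ : CommRing R') (_ : IsLocalRing R') (u' : Fin 3 → R') (h' : R'[X])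
      (φ' : ((blowup C).presheaf.stalk x' : Type) →+* R'[X] ⧸ Ideal.span {h'}) (j₀ : Fin 3),
      IsCPFrame ⟨blowup C, hln', s.L.next (Scheme.hsStratum s.W 3 ν) C, P', x'⟩ R' u' h' φ' ∧
        IsAdicComplete (maximalIdeal R') R' ∧ h'.natDegree = h.natDegree ∧
      (∀ i < h'.natDegree, h'.coeff i ∈ maximalIdeal R' ^ (h'.natDegree - i)) ∧ j₀ ∈ T ∧
      (stalkIdeal (C.comap (blowup.π C)) x').map φ' = Ideal.span {Ideal.Quotient.mk _ (Polynomial.C (u' j₀))} ∧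
      ∀ (K : s.W.IdealSheafData) (j : Fin 3),
        (stalkIdeal K s.pt).map φ = Ideal.span {Ideal.Quotient.mk _ (Polynomial.C (u j))} →
        stalkIdeal (strictTransformIdeal (blowup.π C) C K) x' = ⊤ ∨
          (j ≠ j₀ ∧ (stalkIdeal (strictTransformIdeal (blowup.π C) C K) x').map φ' =
            Ideal.span {Ideal.Quotient.mk _ (Polynomial.C (u' j))}) := by
  classical
  obtain ⟨R', _, _, u', h', φ', β, ι, j₀, hF', hcpl, hdeg, hco, hcompat, hβC, hβX, hj₀T, hu'0, hT, hoff⟩ :=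
    hF.exists_isCPFrame_blowup_tracked hRf hRa hX hs C P' hln' x' hcs hx' hcl hstr T hJ hcoT
  have hF'' := hF'
  obtain ⟨hreg', hloc', hdim', hu', hmon', hφl', hflat', hmap', -, -⟩ := hF''
  haveI := hreg'
  haveI := hloc'
  haveI : IsLocallyNoetherian s.W := s.ln
  haveI : IsLocallyNoetherian (blowup C) := hln'
  haveI : IsDomain R' := isDomain_of_isRegularLocalRing R'
  have hz' : IsRsopPart u' := ⟨hreg', 0, Fin.elim0, by rw [hdim']; rfl, by rw [← hu']; congr 1; ext w; simp⟩
  set B' := R'[X] ⧸ Ideal.span {h'} with hB'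
  set c₀ : B' := Ideal.Quotient.mk _ (Polynomial.C (u' j₀)) with hc₀
  -- the composite `φ' ∘ π♯ = β ∘ φ ∘ (stalk transport)`
  set cong := (s.W.presheaf.stalkCongr (Inseparable.of_eq hx')).hom.hom with hcong
  have hcomp : φ'.comp ((blowup.π C).stalkMap x').hom = β.comp (φ.comp cong) :=
    RingHom.ext fun a => hcompat a
  have htransport : ∀ K : s.W.IdealSheafData,
      ((stalkIdeal K ((blowup.π C).base x')).map ((blowup.π C).stalkMap x').hom).map φ' = ((stalkIdeal K s.pt).map φ).map β := by
    intro K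
    rw [Ideal.map_map, hcomp, stalkIdeal_eq_map_stalkCongr_hom_of_eq hx' K, Ideal.map_map, Ideal.map_map]
    rfl
  -- (E) the exceptional divisor
  have hc₀' : c₀ = Ideal.Quotient.mk _ (Polynomial.C (ι (u j₀))) := by rw [hc₀, hu'0]
  have hexc : (stalkIdeal (C.comap (blowup.π C)) x').map φ' = Ideal.span {c₀} := by
    rw [stalkIdeal_comap_eq_map_stalkMap, htransport C, hJ]
    apply le_antisymm
    · rw [Ideal.map_le_iff_le_comap, Ideal.map_le_iff_le_comap, sup_le_iff, Ideal.map_le_iff_le_comap, Ideal.span_le, Ideal.span_le,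
        Set.singleton_subset_iff]
      refine ⟨?_, ?_⟩
      · rintro _ ⟨t, ht, rfl⟩
        rw [SetLike.mem_coe, Ideal.mem_comap, Ideal.mem_comap, Ideal.mem_comap, hβC]
        by_cases ht0 : t = j₀
        · subst ht0
          rw [← hc₀']
          exact Ideal.mem_span_singleton_self _
        · obtain ⟨tt, htt, -⟩ := hT t (Finset.mem_coe.mp ht) ht0
          rw [htt, map_mul, map_mul, ← hc₀']
          exact Ideal.mul_mem_right _ _ (Ideal.mem_span_singleton_self _)
      · rw [SetLike.mem_coe, Ideal.mem_comap, Ideal.mem_comap, hc₀']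
        exact hβX
    · rw [Ideal.span_singleton_le_iff_mem, hc₀', ← hβC]
      exact Ideal.mem_map_of_mem _ (Ideal.mem_map_of_mem _ (Ideal.mem_sup_left
        (Ideal.mem_map_of_mem _ (Ideal.subset_span ⟨j₀, Finset.mem_coe.mpr hj₀T, rfl⟩))))
  refine ⟨R', inferInstance, inferInstance, u', h', φ', j₀, hF', hcpl, hdeg, hco, hj₀T, hexc, fun K j hK => ?_⟩
  -- (M) an old member read as `(u_j)`
  letI algφ' : Algebra ((blowup C).presheaf.stalk x' : Type) B' := φ'.toAlgebra
  haveI : Module.Flat ((blowup C).presheaf.stalk x' : Type) B' := hflat'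
  have hc₀nzd : c₀ ∈ nonZeroDivisors B' := mk_C_mem_nonZeroDivisors_of_ne_zero hmon' (hz'.ne_zero j₀)
  have hKβ : ((stalkIdeal K ((blowup.π C).base x')).map ((blowup.π C).stalkMap x').hom).map φ' =
      Ideal.span {Ideal.Quotient.mk _ (Polynomial.C (ι (u j)))} := by
    rw [htransport K, hK, Ideal.map_span, Set.image_singleton, hβC]
  -- the stalk of the strict transform, extended to `B'`
  have hsat : (stalkIdeal (strictTransformIdeal (blowup.π C) C K) x').map φ' =
      ⨆ n : ℕ, (Ideal.span {Ideal.Quotient.mk _ (Polynomial.C (ι (u j)))}).colon ((Ideal.span {c₀} ^ n : Ideal B') : Set B') := by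
    rw [stalkIdeal_strictTransformIdeal (blowup.π C) C K x', Ideal.map_iSup]
    refine iSup_congr fun n => ?_
    have hfg : ((stalkIdeal (C.comap (blowup.π C)) x') ^ n).FG := IsNoetherian.noetherian _
    have h1 := Ideal.map_colon_of_flat (A := ((blowup C).presheaf.stalk x' : Type)) (B := B')
      ((stalkIdeal K ((blowup.π C).base x')).map ((blowup.π C).stalkMap x').hom) ((stalkIdeal (C.comap (blowup.π C)) x') ^ n) hfg
    rw [RingHom.algebraMap_toAlgebra] at h1
    rw [h1, Ideal.map_pow, hexc, hKβ]
  -- case analysis on the index `j`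
  by_cases hjT : j ∈ T
  · by_cases hj0 : j = j₀
    · -- the member `V(u_{j₀})`: its strict transform misses the `u_{j₀}`-chart
      left
      subst hj0
      apply eq_top_of_map_eq_top_of_map_maximalIdeal φ' hmap'
      rw [hsat, eq_top_iff]
      refine le_trans ?_ (le_iSup _ 1)
      intro b _
      rw [Submodule.mem_colon]
      intro w hw
      have hw' : w ∈ Ideal.span {c₀} := Ideal.pow_le_self one_ne_zero hw
      rw [smul_eq_mul, ← hc₀']
      exact Ideal.mul_mem_left _ _ hw'
    · obtain ⟨t, ht, htcase⟩ := hT j hjT hj0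
      rcases htcase with rfl | htu
      · -- the transform reads `(u'_j)`
        right
        refine ⟨hj0, ?_⟩
        rw [hsat, ht, map_mul, map_mul, ← hc₀']
        exact iSup_colon_span_singleton_mul_pow_eq (fun b hb => mem_span_mk_C_of_mk_C_mul_mem hz' hmon' (i := j₀) (j := j) (Ne.symm hj0) hb)
          hc₀nzd
      · -- `t` a unit: the transform misses `x'`
        left
        apply eq_top_of_map_eq_top_of_map_maximalIdeal φ' hmap'
        rw [hsat, eq_top_iff]
        refine le_trans ?_ (le_iSup _ 1)
        intro b _
        rw [Submodule.mem_colon]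
        intro w hw
        have hw' : w ∈ Ideal.span {c₀} := Ideal.pow_le_self one_ne_zero hw
        have hunit : IsUnit (Ideal.Quotient.mk (Ideal.span {h'}) (Polynomial.C t)) := htu.map ((Ideal.Quotient.mk (Ideal.span {h'})).comp Polynomial.C)
        rw [smul_eq_mul, ht, map_mul, map_mul, Ideal.span_singleton_mul_right_unit hunit, ← hc₀']
        exact Ideal.mul_mem_left _ _ hw'
  · -- a member transversal to the centre: reads `(u'_j)`
    right
    refine ⟨fun h0 => hjT (h0 ▸ hj₀T), ?_⟩
    rw [hsat, ← hoff j hjT]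
    exact iSup_colon_span_singleton_pow_eq_of_forall_mem
      (fun b hb => mem_span_mk_C_of_mk_C_mul_mem hz' hmon' (i := j₀) (j := j) (fun h0 => hjT (by rw [← h0]; exact hj₀T)) hb)

end Summit.ResolutionOfSingularities.ResolutionOfSingularities.Theorems.SigmaMaxModificationsCorridor3.Moving

end
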